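import Literature.Analysis.Fourier.TrigAutocorrelationDividedDifference
import HarnessLib

/-!
# Connes–Consani–Moscovici 2025, *Zeta spectral triples*, §4–§5.2: the matrix of `QW_λ` in the basis `V_n`,
# the truncation `QW^N_λ`, and the structure of the truncated matrices

RH-FREE corpus literature; CLAIM-UNDER-REVIEW source (arXiv:2511.22755 v1, unrefereed: every unproved printed result below
is a named fact tagged `@[claim … "under-review"]`; definitions and the results PROVED here carry `[cite: …]` locators).
Nothing in this file is worded as, or is, progress toward RH: it fixes the ENTRIES of a finite matrix and their symmetries.

Source, read at the PDF pages (held text `paper:arxiv-2511.22755`, PDF page = printed page + 2): A. Connes, C. Consani,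
H. Moscovici, *Zeta spectral triples*, arXiv:2511.22755 (2025) [bib: `ConnesConsaniMoscovici2025`], §4 "The matrix of
`QW_λ` in the basis `V_n`" (printed pp. 11–15) and §5.1–§5.2 "Truncation of `QW_λ`", "Properties of truncated matrices"
(printed pp. 15–18). PUBLISHED as EMS Ser. Lect. Math. 37 (2026) 39–76, doi:10.4171/elm/37/3
[bib: `ConnesConsaniMoscovici2026`] (cc-lead ruling R4, 2026-08-26: cite both keys; the published text is not held here, so
every locator below is to the arXiv v1 text actually read; the three named facts typed before R4 keep their `claim` tag and
names — `CCM2025_lemma_4_1`, `CCM2025_prop_4_2`, `CCM2025_prop_4_3` — and `CCM2025_prop_4_3` is DISCHARGED below,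
`CCM2025_prop_4_3_holds`).

## Dictionary (cite, never restate)

* `U_n(x) = L^{-1/2} e^{2πinx/L}` on `[0, L]` (CCM (2.6)) IS `Literature.Analysis.Fourier.ConnesVanSuijlekom.trigBasis L n`
  (Connes–van Suijlekom (4.2)); CCM's even kernel `q(U_n, U_m)(y) = (U_n^* ∗ U_m)(y) + (U_n^* ∗ U_m)(-y)` (CCM (2.4), Lemma 2.3)
  IS `ConnesVanSuijlekom.symAutocorr L n m y` (its closed forms on `[0, L]` are `symAutocorr_of_ne` = CCM (2.8) and
  `symAutocorr_self` = CCM (2.10)); below `qKer L n m` is its real part (the kernel is real on `[0, L]`).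
* CCM's Weil functional `Ψ = W_{0,2} − W_ℝ − Σ_p W_p` ((3.10)) on a function `F` of `u ∈ ℝ₊*` is the tree's
  `Literature.NumberTheory.LFunctions.weilFunctional` of the additive avatar `F ∘ exp` (polar term `F̂(i/2) + F̂(−i/2)` =
  `weilPolarTerm`, `Σ_p W_p` = `weilPrimeTerm`, `−W_ℝ = W_∞` = `weilArchTermBombieri`, term by term); `QW_λ(f, f)` is
  `weilQuadratic` of the avatar (cf. `WeilSemilocalCompactness.lean`). The identification of the matrix (5.1) below with the
  matrix of `QW_λ` restricted to `E_N = span{V_n : |n| ≤ N}` is CCM Prop. 3.2 (ii) (`QW(κf, κg) = Ψ♯(q(f, g) ∘ log)`, §3 —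
  typed in the §2–§3 module of this directory); here (5.1) is taken as the DEFINITION of the truncated matrix, written, as
  printed, as the pairing of `q(U_n, U_m)` with the distribution `D = log_*(Ψ♯)` on `[0, L]`.
* §5.2 "recalls the basic properties of [7]" = Connes–van Suijlekom 2025 §5, which the tree PROVES for an abstract matrix of
  divided-difference form in `Literature/LinearAlgebra/Matrix/LoewnerFormKernelRealRoots.lean`: CCM Lemma 5.2 (ii) eq. (5.3)
  `DT − TD = |β⟩⟨η| − |η⟩⟨β|` = `ConnesVanSuijlekom.commutator_of_dividedDifference` / `commutator_apply`; CCM Lemma 5.4 (i)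
  `T D ξ = −β` = `mulVec_D_kernel`; (ii) `D' = D − |Dξ⟩⟨η|` self-adjoint for `⟨·∣·⟩_T` = `dPrime_adjoint`; (iii) eq. (5.5)
  with (5.7), `Det(D' − s) = −s Det(D − s) Σ_j ξ_j/(j − s)` = `det_dPrimeMatrix_sub` (and `…_eq_zero_iff`). They are NOT
  restated; this file supplies what is specific to CCM: that the truncated WEIL matrix has that form (Lemma 5.1, PROVED), its
  `ℤ/2`-symmetry (Lemma 5.2 (i), PROVED), and Definition 5.3.

## What is here (printed item → declaration → status)

* §4.3 notations: `rho` (`ρ(x) = e^{x/2}/(e^x − e^{−x})`, p. 12), `lerchPhi` (Hurwitz–Lerch `Φ(z, s, x)`, p. 12; Mathlib has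
  `ordinaryHypergeometric` = `₂F₁` and `Complex.digamma` = `ψ`, used as such), `alphaL`/`betaL`/`gammaL` ((4.12)–(4.14)),
  `cL`/`wL` (the constants `c(L)`, `w(L)`, p. 14) — DEFINITIONS.
* The three pieces of `D = log_*(Ψ♯)` on `[0, L]` in the variable `y = log x`: `polarSharp` (`W♯_{0,2}`, (3.14)),
  `archSharp` (`W♯_ℝ` in the form (4.4)), `primeSharp` (`Σ_p W♯_p`, (3.16)/(4.3)), `weilDistribution = polarSharp − archSharp −
  primeSharp` (`Ψ♯`, (3.13)) — DEFINITIONS; `weilDistribution_congr` (it only sees `[0, L]`) — PROVED.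
* Lemma 4.1 (`W_{0,2}(V_n, V_m)` in closed form) → `CCM2025_lemma_4_1` — CLAIM (named fact; "best verified by direct
  computation", an elementary integral, dischargeable).
* (4.3) (`Σ_p W_p(V_n, V_m)`) → `primeSharp_qKer` — PROVED (definitional).
* Prop. 4.2 (the three `ρ`-integrals via `₂F₁`, `ψ`, `ψ⁽¹⁾`, `Φ`) → `CCM2025_prop_4_2` — CLAIM (transcription checked
  numerically to 8 digits at `L ∈ {log 13, 5}`, `n ∈ {1, 2, 5}` before typing; no numerics are asserted).
* Prop. 4.3 (`W_ℝ(V_n, V_m)` via `α_L, β_L, γ_L`) → `CCM2025_prop_4_3` — named fact over the CORRECTED `γ_L`, see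
  "Misprint" below — DISCHARGED: `CCM2025_prop_4_3_holds` (from (4.4) and Lemma 2.3, last section of this file).
* (5.1) → `truncatedWeilMatrix L N` (indices `Finset.Icc (−N) N ⊂ ℤ`, entries `D(q(U_n, U_m))`) — DEFINITION;
  Lemma 5.1 → `bCoeff`, `aCoeff` (DEFINITIONS of `b_n`, `a_n`) and `truncatedWeilMatrix_apply_of_ne` (`τ_{ij} = (b_i − b_j)/(i − j)`),
  `truncatedWeilMatrix_apply_self` (`τ_{ii} = a_i`), `aCoeff_neg` (`a_{−j} = a_j`), `bCoeff_neg` (`b_{−j} = −b_j`),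
  `truncatedWeilMatrix_symm` (real symmetric) — PROVED.
* Lemma 5.2 (i) (`γ² = id`, `Tγ = γT` for `γ V_j = V_{−j}`) → `truncatedWeilMatrix_reflect` — PROVED; (ii) → the commutation
  relation for THIS matrix, `truncatedWeilMatrix_commutator`, from the tree's `commutator_of_dividedDifference` — PROVED.
* Definition 5.3 (even-simple) → `IsEvenSimple` — DEFINITION, in the operator-free form consumed by the tree's real-zeros
  theorems (`T − ε ≥ 0` with one-dimensional kernel spanned by an even vector), with `IsEvenSimple.exists_posSemidef`.

## Misprint recorded (v1, p. 15, eq. (4.14))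

Printed: `γ_L(n) := ∫₀ᴸ (cos(2πnx/L) − e^{−x/2}) ρ(x) dx + c(L) + w(L)` with `c(L) = ∫₀ᴸ (1 − e^{−x/2})/(eˣ − e^{−x}) dx`
(p. 14, with its closed form). From (4.4) and Lemma 2.3 (`ω = q(U_n, U_n) = 2(1 − x/L) cos(2πnx/L)`, `ω(0) = 2`) one gets
`W_ℝ(V_n, V_n) = 2w(L) + 2∫₀ᴸ (cos(2πnx/L) − e^{−x/2}) ρ(x) dx − 2β_L(n)` identically (pointwise
`(e^{x/2}ω(x) − 2)/(eˣ − e^{−x}) = 2(cos − e^{−x/2})ρ − (2/L) x cos ρ`), so the diagonal of Prop. 4.3, `2γ_L(n) − 2β_L(n)`,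
holds iff the summand `+ c(L)` is absent from (4.14) (numerically the printed `γ_L` overshoots by `2c(L) ≈ 0.752` at
`L = log 13`). `gammaL` below is therefore `∫₀ᴸ (cos(2πnx/L) − e^{−x/2}) ρ(x) dx + w(L)` (equivalently, by (4.11),
`∫₀ᴸ (cos − 1)ρ + w(L)` plus the correction `∫₀ᴸ (e^{x/2} − 1)/(eˣ − e^{−x}) dx`, which is what (4.11) requires in place of
the printed `c(L)`); `cL` is kept as printed. The off-diagonal entries are as printed.

Deliberately NOT here: §5.3–§5.6 (Dirichlet kernel, perturbed scaling operator, regularised determinant, Prop. 5.9,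
Thm. 5.10 — the companion module `ZetaSpectralTriplesInfraredB`), the link (5.1) = matrix of `QW_λ|E_N` (Prop. 3.2, §3
module), §6 numerics (not typed), §7 (`Literature/NumberTheory/LFunctions/ConnesProlateGuess*.lean`), anything about RH.
-/

noncomputable section

open Set MeasureTheory Complex Finset intervalIntegral Matrix
open Literature.Analysis.Fourier.ConnesVanSuijlekom

open scoped Real ArithmeticFunction.vonMangoldt

namespace Literature.NumberTheory.ConnesConsani2025

/-! ## §4.3 notations -/

/-- `ρ(x) := e^{x/2}/(eˣ − e^{−x})` (CCM p. 12, before Prop. 4.2); `ρ(x) ~ 1/(2x)` at `0` (Lean: `ρ(0) = 1/0 = 0`, a null set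
for the integrals below). [cite: ConnesConsaniMoscovici2025, §4.3 p. 12 (definition of ρ)] -/
def rho (x : ℝ) : ℝ := Real.exp (x / 2) / (Real.exp x - Real.exp (-x))

/-- The Hurwitz–Lerch function `Φ(z, s, x) = Σ_{k ≥ 0} z^k/(x + k)^s` (CCM p. 12 use `Φ(z, 2, x) = 1/x² + z/(x+1)² + …`,
`|z| < 1`). [cite: ConnesConsaniMoscovici2025, §4.3 p. 12 (notation Φ)] -/
def lerchPhi (z s x : ℂ) : ℂ := ∑' k : ℕ, z ^ k / (x + k) ^ s

/-- The real kernel `q(U_n, U_m)(y)` (CCM (2.4), Lemma 2.3): the real part of the tree's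
`ConnesVanSuijlekom.symAutocorr L n m y` (which is real on `[0, L]` by `symAutocorr_of_ne` / `symAutocorr_self`).
[cite: ConnesConsaniMoscovici2025, Lemma 2.3 and eq. (4.1)] -/
def qKer (L : ℝ) (n m : ℤ) (y : ℝ) : ℝ := (symAutocorr L n m y).re

/-- `q(U_n, U_m)(y) = (sin(2πmy/L) − sin(2πny/L))/(π(n − m))` for `n ≠ m`, `y ∈ [0, L]` (CCM (2.8) / Lemma 2.3; the tree's
C–vS (4.4)). [cite: ConnesConsaniMoscovici2025, Lemma 2.3 (m ≠ n)] -/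
theorem qKer_of_ne {L : ℝ} (hL : 0 < L) {n m : ℤ} (hnm : n ≠ m) {y : ℝ} (hy : y ∈ Icc 0 L) :
    qKer L n m y = (Real.sin (2 * π * m * y / L) - Real.sin (2 * π * n * y / L)) / (π * (n - m)) := by
  rw [qKer, symAutocorr_of_ne hL hnm hy, ofReal_re]
  have h1 : (π * ((m : ℝ) - n)) = -(π * (n - m)) := by ring
  rw [h1, div_neg, ← neg_div, neg_sub]

/-- `q(U_n, U_n)(y) = 2(1 − y/L) cos(2πny/L)` for `y ∈ [0, L]` (CCM (2.10) / Lemma 2.3; the tree's C–vS (4.5)).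
[cite: ConnesConsaniMoscovici2025, Lemma 2.3 (m = n)] -/
theorem qKer_self {L : ℝ} (hL : 0 < L) (n : ℤ) {y : ℝ} (hy : y ∈ Icc 0 L) :
    qKer L n n y = 2 * (1 - y / L) * Real.cos (2 * π * n * y / L) := by
  rw [qKer, symAutocorr_self hL n hy, ofReal_re]

/-! ## The distribution `D = log_*(Ψ♯)` on `[0, L]`: the three pieces of (3.13) in the variable `y = log x` -/

/-- `W♯_{0,2}(F) = ∫₁^∞ F(x)(x^{1/2} + x^{−1/2}) d*x` (CCM (3.14)) for `F = φ ∘ log` with `φ` read on `[0, L]`: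
`∫₀ᴸ φ(y)(e^{y/2} + e^{−y/2}) dy`. [cite: ConnesConsaniMoscovici2025, eq. (3.14) and §4.1] -/
def polarSharp (L : ℝ) (φ : ℝ → ℝ) : ℝ :=
  ∫ y in (0 : ℝ)..L, φ y * (Real.exp (y / 2) + Real.exp (-(y / 2)))

/-- `W♯_ℝ(F)` (CCM (3.15)) for `F = φ ∘ log`, `φ` read on `[0, L]`, in the form (4.4):
`φ(0)/2 · (γ + log(4π (eᴸ − 1)/(eᴸ + 1))) + ∫₀ᴸ (e^{y/2} φ(y) − φ(0))/(e^y − e^{−y}) dy`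
(from (3.15) by `∫_L^∞ dy/(e^y − e^{−y}) = ½ log((eᴸ + 1)/(eᴸ − 1))`, p. 12). At `y = 0` the integrand extends continuously;
Lean's `x/0 = 0` there is a null set. [cite: ConnesConsaniMoscovici2025, eq. (4.4) p. 12] -/
def archSharp (L : ℝ) (φ : ℝ → ℝ) : ℝ :=
  φ 0 / 2 * (Real.eulerMascheroniConstant + Real.log (4 * π * (Real.exp L - 1) / (Real.exp L + 1)))
    + ∫ y in (0 : ℝ)..L, (Real.exp (y / 2) * φ y - φ 0) / (Real.exp y - Real.exp (-y))

/-- `Σ_p W♯_p(F) = Σ_{1 < k ≤ eᴸ} Λ(k) k^{−1/2} F(k)` (CCM (3.16), (4.3)) for `F = φ ∘ log`: the finite sum over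
`2 ≤ k ≤ ⌊eᴸ⌋`. [cite: ConnesConsaniMoscovici2025, eq. (4.3) p. 11] -/
def primeSharp (L : ℝ) (φ : ℝ → ℝ) : ℝ :=
  ∑ k ∈ Finset.Icc 2 ⌊Real.exp L⌋₊, Λ k * (k : ℝ) ^ (-(1 / 2 : ℝ)) * φ (Real.log k)

/-- The real distribution `D = log_*(Ψ♯)` on `[0, L]` (CCM (5.1): "where `D` is the real distribution `log_*(Ψ♯)` on the
interval `[0, L]`", with `Ψ♯ = W♯_{0,2} − W♯_ℝ − Σ W♯_p` of (3.13)), as a functional on functions `φ` of `y = log x`.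
[cite: ConnesConsaniMoscovici2025, eq. (3.13) and eq. (5.1)] -/
def weilDistribution (L : ℝ) (φ : ℝ → ℝ) : ℝ :=
  polarSharp L φ - archSharp L φ - primeSharp L φ

/-- `D` only sees the restriction of `φ` to `[0, L]` (it is a distribution ON `[0, L]`). [cite: ConnesConsaniMoscovici2025, eq. (5.1) (D is a distribution on [0, L])] -/
theorem weilDistribution_congr {L : ℝ} (hL : 0 < L) {φ ψ : ℝ → ℝ} (h : EqOn φ ψ (Icc 0 L)) :
    weilDistribution L φ = weilDistribution L ψ := by
  have h0 : φ 0 = ψ 0 := h ⟨le_rfl, hL.le⟩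
  have hu : ∀ y ∈ uIcc (0 : ℝ) L, y ∈ Icc (0 : ℝ) L := fun y hy => by rwa [uIcc_of_le hL.le] at hy
  have h1 : polarSharp L φ = polarSharp L ψ :=
    integral_congr fun y hy => by simp only [h (hu y hy)]
  have h2 : archSharp L φ = archSharp L ψ := by
    unfold archSharp
    rw [h0]
    congr 1
    exact integral_congr fun y hy => by simp only [h (hu y hy)]
  have h3 : primeSharp L φ = primeSharp L ψ := by
    refine sum_congr rfl fun k hk => ?_
    rw [Finset.mem_Icc] at hk
    have hk2 : (2 : ℝ) ≤ k := by exact_mod_cast hk.1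
    have hmem : Real.log k ∈ Icc (0 : ℝ) L := by
      refine ⟨Real.log_nonneg (by linarith), ?_⟩
      rw [Real.log_le_iff_le_exp (by linarith)]
      exact (Nat.cast_le.mpr hk.2).trans (Nat.floor_le (Real.exp_pos L).le)
    rw [h hmem]
  rw [weilDistribution, weilDistribution, h1, h2, h3]

/-! ## §4: the entries `W_{0,2}(V_n, V_m)`, `W_p(V_n, V_m)`, `W_ℝ(V_n, V_m)` -/

/-- CLAIM (**CCM Lemma 4.1**, p. 11: "best verified by direct computation"): for `F(x) = q(U_n, U_m)(log x)`,
`W_{0,2}(V_n, V_m) = W♯_{0,2}(F) = 32 L sinh²(L/4) (L² − 16π² m n)/((L² + 16π² m²)(L² + 16π² n²))`.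
RH-FREE; an elementary trigonometric–exponential integral (dischargeable). -/
@[claim "ConnesConsaniMoscovici2025" "under-review"]
def CCM2025_lemma_4_1 : Prop :=
  ∀ L : ℝ, 0 < L → ∀ n m : ℤ,
    polarSharp L (qKer L n m) =
      32 * L * Real.sinh (L / 4) ^ 2 * (L ^ 2 - 16 * π ^ 2 * m * n) /
        ((L ^ 2 + 16 * π ^ 2 * (m : ℝ) ^ 2) * (L ^ 2 + 16 * π ^ 2 * (n : ℝ) ^ 2))

/-- **CCM (4.3)**: `Σ_p W_p(V_n, V_m) = Σ_{1 < k ≤ eᴸ} Λ(k) k^{−1/2} q(U_n, U_m)(log k)` (definitional here).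
[cite: ConnesConsaniMoscovici2025, eq. (4.3) p. 11] -/
theorem primeSharp_qKer (L : ℝ) (n m : ℤ) :
    primeSharp L (qKer L n m) =
      ∑ k ∈ Finset.Icc 2 ⌊Real.exp L⌋₊, Λ k * (k : ℝ) ^ (-(1 / 2 : ℝ)) * qKer L n m (Real.log k) := rfl

/-- `α_L(n) := (1/π) ∫₀ᴸ sin(2πnx/L) ρ(x) dx` (CCM (4.12)). [cite: ConnesConsaniMoscovici2025, eq. (4.12) p. 15] -/
def alphaL (L : ℝ) (n : ℤ) : ℝ := (1 / π) * ∫ x in (0 : ℝ)..L, Real.sin (2 * π * n * x / L) * rho x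

/-- `β_L(n) := (1/L) ∫₀ᴸ x cos(2πnx/L) ρ(x) dx` (CCM (4.13)). [cite: ConnesConsaniMoscovici2025, eq. (4.13) p. 15] -/
def betaL (L : ℝ) (n : ℤ) : ℝ := (1 / L) * ∫ x in (0 : ℝ)..L, x * Real.cos (2 * π * n * x / L) * rho x

/-- The correction term `c(L) := ∫₀ᴸ (1 − e^{−x/2})/(eˣ − e^{−x}) dx` of (4.11), AS PRINTED (p. 14; printed closed form
`log(e^{L/2} + 1) + ¼(−2 log(eᴸ + 1) − π − log 4) + tan⁻¹(e^{L/2})`, which matches this integral). See the module docstring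
("Misprint recorded") for why it does not enter `gammaL`. [cite: ConnesConsaniMoscovici2025, eq. (4.11) p. 14 (the term c(L))] -/
def cL (L : ℝ) : ℝ := ∫ x in (0 : ℝ)..L, (1 - Real.exp (-(x / 2))) / (Real.exp x - Real.exp (-x))

/-- `w(L) := ½(γ + log 4π) − ½ log((eᴸ + 1)/(eᴸ − 1))` (p. 14: "to take into account the full Weil principal value").
[cite: ConnesConsaniMoscovici2025, §4.3 p. 14 (the term w(L))] -/
def wL (L : ℝ) : ℝ :=
  (Real.eulerMascheroniConstant + Real.log (4 * π)) / 2 - Real.log ((Real.exp L + 1) / (Real.exp L - 1)) / 2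

/-- `γ_L(n) := ∫₀ᴸ (cos(2πnx/L) − e^{−x/2}) ρ(x) dx + w(L)` — CCM (4.14) WITH THE PRINTED SUMMAND `+ c(L)` REMOVED (misprint
in v1: with it the diagonal identity of Prop. 4.3 fails by `2c(L) ≠ 0`; see the module docstring).
[cite: ConnesConsaniMoscovici2025, eq. (4.14) p. 15 (corrected: without + c(L))] -/
def gammaL (L : ℝ) (n : ℤ) : ℝ :=
  (∫ x in (0 : ℝ)..L, (Real.cos (2 * π * n * x / L) - Real.exp (-(x / 2))) * rho x) + wL L

/-- CLAIM (**CCM Proposition 4.2**, p. 13), the three `ρ`-integrals in closed form (`ψ` = digamma = `Complex.digamma`,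
`ψ⁽¹⁾ = deriv ψ`, `₂F₁ = ordinaryHypergeometric`, `Φ = lerchPhi`, `z = e^{−2L}`, `b = πin/L + 1/4`):
(4.5) `∫₀ᴸ sin(2πnx/L)ρ(x)dx = e^{−L/2} Im(2L/(L + 4πin) ₂F₁(1, b; b + 1; e^{−2L})) + ½ Im ψ(b)`;
(4.6) `∫₀ᴸ x cos(2πnx/L)ρ(x)dx = −L e^{−L/2} Im(2L/(4πn − iL) ₂F₁(1, b; b + 1; e^{−2L})) − (e^{−L/2}/4) Re Φ(e^{−2L}, 2, b)
  + ¼ Re ψ⁽¹⁾(b)`;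
(4.7) `∫₀ᴸ (cos(2πnx/L) − 1)ρ(x)dx = −e^{−L/2} Re(2L/(L + 4πin) ₂F₁(1, b; b + 1; e^{−2L})) + 2e^{−L/2} ₂F₁(¼, 1; 5/4; e^{−2L})
  − ½ Re(ψ(b) − ψ(¼))`. RH-FREE (termwise integration of `ρ(x) = Σ_k e^{−(1+4k)x/2}`, dischargeable). -/
@[claim "ConnesConsaniMoscovici2025" "under-review"]
def CCM2025_prop_4_2 : Prop :=
  ∀ L : ℝ, 0 < L → ∀ n : ℤ,
    let b : ℂ := π * I * n / L + 1 / 4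
    let z : ℂ := (Real.exp (-2 * L) : ℂ)
    (∫ x in (0 : ℝ)..L, Real.sin (2 * π * n * x / L) * rho x) =
        Real.exp (-L / 2) * (2 * L / (L + 4 * π * I * n) * ordinaryHypergeometric (1 : ℂ) b (b + 1) z).im
          + (1 / 2) * (Complex.digamma b).im ∧
    (∫ x in (0 : ℝ)..L, x * Real.cos (2 * π * n * x / L) * rho x) =
        -L * Real.exp (-L / 2) * (2 * L / (4 * π * n - I * L) * ordinaryHypergeometric (1 : ℂ) b (b + 1) z).im
          - Real.exp (-L / 2) / 4 * (lerchPhi z 2 b).re + (1 / 4) * (deriv Complex.digamma b).re ∧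
    (∫ x in (0 : ℝ)..L, (Real.cos (2 * π * n * x / L) - 1) * rho x) =
        -Real.exp (-L / 2) * (2 * L / (L + 4 * π * I * n) * ordinaryHypergeometric (1 : ℂ) b (b + 1) z).re
          + 2 * Real.exp (-L / 2) * (ordinaryHypergeometric (1 / 4 : ℂ) 1 (5 / 4) z).re
          - (1 / 2) * (Complex.digamma b - Complex.digamma (1 / 4)).re

/-- CLAIM (**CCM Proposition 4.3**, p. 15): the matrix `W_ℝ(V_n, V_m)` is `(α_L(m) − α_L(n))/(n − m)` for `m ≠ n` and
`2γ_L(n) − 2β_L(n)` for `m = n` ("Follows from Lemma 2.3" and (4.4)); here `W_ℝ(V_n, V_m) = W♯_ℝ` of `q(U_n, U_m) ∘ log`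
(`archSharp`), and `γ_L` is the corrected (4.14) (module docstring). RH-FREE; dischargeable from (4.4) by linearity of the
integral (the `ρ`-weighted kernels are bounded on `(0, L]`). -/
@[claim "ConnesConsaniMoscovici2025" "under-review"]
def CCM2025_prop_4_3 : Prop :=
  ∀ L : ℝ, 0 < L → ∀ n m : ℤ,
    archSharp L (qKer L n m) = if n = m then 2 * gammaL L n - 2 * betaL L n else (alphaL L m - alphaL L n) / (n - m)

/-! ## §5.1: the truncation `QW^N_λ` and Lemma 5.1 -/

/-- **CCM (5.1)**: the matrix `τ_{n,m} = ∫₀ᴸ q(U_n, U_m)(y) D(y)`, `n, m ∈ {−N, …, N}`, of the truncated Weil quadratic form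
`QW^N_λ` (`L = 2 log λ`) in the basis `V_n` — DEFINED as the pairing of the kernel with `D = log_*(Ψ♯)`; that this is the
matrix of `QW_λ` on `E_N` is Prop. 3.2 (ii) / (3.18) (§3 module). [cite: ConnesConsaniMoscovici2025, eq. (5.1) p. 15] -/
def truncatedWeilMatrix (L : ℝ) (N : ℕ) :
    Matrix (Finset.Icc (-(N : ℤ)) N) (Finset.Icc (-(N : ℤ)) N) ℝ :=
  Matrix.of fun n m => weilDistribution L (qKer L n m)

/-- `b_n := −(1/π) ∫₀ᴸ sin(2πny/L) D(y)` (CCM Lemma 5.1, proof). [cite: ConnesConsaniMoscovici2025, Lemma 5.1 (proof, b_n) p. 16] -/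
def bCoeff (L : ℝ) (n : ℤ) : ℝ := -(1 / π) * weilDistribution L fun y => Real.sin (2 * π * n * y / L)

/-- `a_n := 2 ∫₀ᴸ (1 − y/L) cos(2πny/L) D(y)` (CCM Lemma 5.1, proof). [cite: ConnesConsaniMoscovici2025, Lemma 5.1 (proof, a_n) p. 16] -/
def aCoeff (L : ℝ) (n : ℤ) : ℝ := weilDistribution L fun y => 2 * (1 - y / L) * Real.cos (2 * π * n * y / L)

/-- **CCM Lemma 5.1, `a_{−j} = a_j`.** [cite: ConnesConsaniMoscovici2025, Lemma 5.1 p. 16] -/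
theorem aCoeff_neg (L : ℝ) (n : ℤ) : aCoeff L (-n) = aCoeff L n := by
  unfold aCoeff
  congr 1
  funext y
  rw [Int.cast_neg, show 2 * π * -(n : ℝ) * y / L = -(2 * π * n * y / L) by ring, Real.cos_neg]

/-- Negation passes through `D` (no integrability needed: `∫ −f = −∫ f` unconditionally). [cite: ConnesConsaniMoscovici2025, eq. (5.1) (linearity of D)] -/
theorem weilDistribution_neg (L : ℝ) (φ : ℝ → ℝ) :
    weilDistribution L (fun y => -φ y) = -weilDistribution L φ := by
  have h1 : polarSharp L (fun y => -φ y) = -polarSharp L φ := by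
    unfold polarSharp
    rw [← intervalIntegral.integral_neg]
    exact integral_congr fun y _ => by ring
  have h2 : archSharp L (fun y => -φ y) = -archSharp L φ := by
    unfold archSharp
    rw [neg_add, ← intervalIntegral.integral_neg]
    congr 1
    · ring
    · exact integral_congr fun y _ => by ring
  have h3 : primeSharp L (fun y => -φ y) = -primeSharp L φ := by
    unfold primeSharp
    rw [← Finset.sum_neg_distrib]
    exact Finset.sum_congr rfl fun k _ => by ring
  rw [weilDistribution, weilDistribution, h1, h2, h3]
  ring

/-- **CCM Lemma 5.1, `b_{−j} = −b_j`.** [cite: ConnesConsaniMoscovici2025, Lemma 5.1 p. 16] -/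
theorem bCoeff_neg (L : ℝ) (n : ℤ) : bCoeff L (-n) = -bCoeff L n := by
  unfold bCoeff
  have h : (fun y => Real.sin (2 * π * ((-n : ℤ) : ℝ) * y / L)) = fun y => -Real.sin (2 * π * n * y / L) := by
    funext y
    rw [Int.cast_neg, show 2 * π * -(n : ℝ) * y / L = -(2 * π * n * y / L) by ring, Real.sin_neg]
  rw [h, weilDistribution_neg]
  ring

/-! ### Lemma 5.1: the truncated Weil matrix is a real symmetric divided-difference matrix -/

/-- `eʸ − e^{−y} = 2 sinh y ≥ 2y` for `y ≥ 0`. [folklore] -/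
private theorem two_mul_le_exp_sub_exp_neg {y : ℝ} (hy : 0 ≤ y) : 2 * y ≤ Real.exp y - Real.exp (-y) := by
  have h := Real.self_le_sinh_iff.mpr hy
  rw [Real.sinh_eq] at h
  linarith

/-- The `W♯_ℝ`-integrand of the sine kernel is bounded on `(0, L]`:
`|e^{y/2} sin(ay)/(eʸ − e^{−y})| ≤ e^{L/2}|a|/2` (from `|sin(ay)| ≤ |a|y`, `eʸ − e^{−y} ≥ 2y`). [folklore] -/
private theorem sinKernel_bound {L a y : ℝ} (hy : 0 < y) (hyL : y ≤ L) :
    |Real.exp (y / 2) * Real.sin (a * y) / (Real.exp y - Real.exp (-y))| ≤ Real.exp (L / 2) * |a| / 2 := by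
  have hden : 2 * y ≤ Real.exp y - Real.exp (-y) := two_mul_le_exp_sub_exp_neg hy.le
  have hden0 : 0 < Real.exp y - Real.exp (-y) := by linarith
  rw [abs_div, abs_mul, abs_of_pos (Real.exp_pos _), abs_of_pos hden0, div_le_iff₀ hden0]
  have hsin : |Real.sin (a * y)| ≤ |a| * y := by
    calc |Real.sin (a * y)| ≤ |a * y| := Real.abs_sin_le_abs
      _ = |a| * y := by rw [abs_mul, abs_of_pos hy]
  have hexp : Real.exp (y / 2) ≤ Real.exp (L / 2) := Real.exp_le_exp.mpr (by linarith)
  calc Real.exp (y / 2) * |Real.sin (a * y)| ≤ Real.exp (L / 2) * (|a| * y) :=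
        mul_le_mul hexp hsin (abs_nonneg _) (Real.exp_pos _).le
    _ = Real.exp (L / 2) * |a| / 2 * (2 * y) := by ring
    _ ≤ Real.exp (L / 2) * |a| / 2 * (Real.exp y - Real.exp (-y)) :=
        mul_le_mul_of_nonneg_left hden (by positivity)

/-- The `W♯_ℝ`-integrand of the sine kernel `y ↦ sin(ay)` is interval-integrable on `[0, L]` (bounded and measurable;
the singularity `ρ(y) ~ 1/(2y)` is cancelled by `sin(ay)`). [folklore] -/
private theorem intervalIntegrable_sinKernel {L : ℝ} (hL : 0 < L) (a : ℝ) :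
    IntervalIntegrable (fun y => Real.exp (y / 2) * Real.sin (a * y) / (Real.exp y - Real.exp (-y)))
      volume 0 L := by
  rw [intervalIntegrable_iff_integrableOn_Ioc_of_le hL.le]
  refine Measure.integrableOn_of_bounded (M := Real.exp (L / 2) * |a| / 2) measure_Ioc_lt_top.ne
    (by fun_prop : Measurable fun y =>
      Real.exp (y / 2) * Real.sin (a * y) / (Real.exp y - Real.exp (-y))).aestronglyMeasurable ?_
  rw [ae_restrict_iff' measurableSet_Ioc]
  exact Filter.Eventually.of_forall fun y hy => by
    rw [Real.norm_eq_abs]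
    exact sinKernel_bound hy.1 hy.2

/-- `D` applied to the sine kernel `y ↦ sin(2πky/L)`: the `φ(0)`-terms of `W♯_ℝ` drop (`sin 0 = 0`).
[cite: ConnesConsaniMoscovici2025, Lemma 5.1 (proof) p. 16] -/
theorem weilDistribution_sin (L : ℝ) (k : ℤ) :
    weilDistribution L (fun y => Real.sin (2 * π * k * y / L))
      = (∫ y in (0 : ℝ)..L, Real.sin (2 * π * k * y / L) * (Real.exp (y / 2) + Real.exp (-(y / 2))))
        - (∫ y in (0 : ℝ)..L, Real.exp (y / 2) * Real.sin (2 * π * k * y / L) / (Real.exp y - Real.exp (-y)))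
        - ∑ j ∈ Finset.Icc 2 ⌊Real.exp L⌋₊, Λ j * (j : ℝ) ^ (-(1 / 2 : ℝ)) * Real.sin (2 * π * k * Real.log j / L) := by
  simp only [weilDistribution, polarSharp, archSharp, primeSharp, mul_zero, zero_div, Real.sin_zero, zero_mul,
    zero_add, sub_zero]

/-- **CCM Lemma 5.1 (off-diagonal entries):** `τ_{i,j} = (b_i − b_j)/(i − j)` for `i ≠ j`, with
`b_n = −(1/π) ∫₀ᴸ sin(2πny/L) D(y)` (`bCoeff`). Proof as printed: `q(U_i, U_j) = (sin(2πjy/L) − sin(2πiy/L))/(π(i − j))`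
on `[0, L]` and linearity of `D` (the `ρ`-weighted sine kernels are integrable). [cite: ConnesConsaniMoscovici2025, Lemma 5.1 eq. (5.2) p. 16] -/
theorem truncatedWeilMatrix_apply_of_ne {L : ℝ} (hL : 0 < L) (N : ℕ) {i j : Finset.Icc (-(N : ℤ)) N}
    (hij : i ≠ j) :
    truncatedWeilMatrix L N i j = (bCoeff L i - bCoeff L j) / ((i : ℤ) - (j : ℤ) : ℝ) := by
  have hij' : (i : ℤ) ≠ (j : ℤ) := fun h => hij (Subtype.ext h)
  have hc : (π * (((i : ℤ) : ℝ) - ((j : ℤ) : ℝ))) ≠ 0 :=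
    mul_ne_zero Real.pi_ne_zero (sub_ne_zero.mpr (by exact_mod_cast hij'))
  -- the entry is `D` of the closed-form kernel
  have h1 : truncatedWeilMatrix L N i j = weilDistribution L (fun y =>
      (Real.sin (2 * π * (j : ℤ) * y / L) - Real.sin (2 * π * (i : ℤ) * y / L)) / (π * ((i : ℤ) - (j : ℤ)))) := by
    rw [truncatedWeilMatrix, Matrix.of_apply]
    exact weilDistribution_congr hL fun y hy => qKer_of_ne hL hij' hy
  rw [h1]
  -- abbreviations for the two sine kernels and their three pairings
  set si : ℝ → ℝ := fun y => Real.sin (2 * π * (i : ℤ) * y / L) with hsi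
  set sj : ℝ → ℝ := fun y => Real.sin (2 * π * (j : ℤ) * y / L) with hsj
  set c : ℝ := π * (((i : ℤ) : ℝ) - ((j : ℤ) : ℝ)) with hcdef
  have hPi : IntervalIntegrable (fun y => si y * (Real.exp (y / 2) + Real.exp (-(y / 2)))) volume 0 L := by
    apply Continuous.intervalIntegrable; simp only [hsi]; fun_prop
  have hPj : IntervalIntegrable (fun y => sj y * (Real.exp (y / 2) + Real.exp (-(y / 2)))) volume 0 L := by
    apply Continuous.intervalIntegrable; simp only [hsj]; fun_prop
  have hRi : IntervalIntegrable (fun y => Real.exp (y / 2) * si y / (Real.exp y - Real.exp (-y))) volume 0 L := by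
    have h := intervalIntegrable_sinKernel hL (2 * π * (i : ℤ) / L)
    refine h.congr fun y _ => ?_
    simp only [hsi]; ring_nf
  have hRj : IntervalIntegrable (fun y => Real.exp (y / 2) * sj y / (Real.exp y - Real.exp (-y))) volume 0 L := by
    have h := intervalIntegrable_sinKernel hL (2 * π * (j : ℤ) / L)
    refine h.congr fun y _ => ?_
    simp only [hsj]; ring_nf
  -- `D((sj − si)/c) = (D sj − D si)/c`, piece by piece
  have hP : polarSharp L (fun y => (sj y - si y) / c)
      = (polarSharp L sj - polarSharp L si) / c := by
    unfold polarSharp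
    rw [← intervalIntegral.integral_sub hPj hPi, ← intervalIntegral.integral_div]
    exact integral_congr fun y _ => by ring
  have hR : archSharp L (fun y => (sj y - si y) / c) = (archSharp L sj - archSharp L si) / c := by
    unfold archSharp
    have h0i : si 0 = 0 := by simp [hsi]
    have h0j : sj 0 = 0 := by simp [hsj]
    simp only [h0i, h0j, sub_zero, zero_div, zero_mul, zero_add, sub_self]
    rw [← intervalIntegral.integral_sub hRj hRi, ← intervalIntegral.integral_div]
    exact integral_congr fun y _ => by ring
  have hS : primeSharp L (fun y => (sj y - si y) / c) = (primeSharp L sj - primeSharp L si) / c := by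
    unfold primeSharp
    rw [← Finset.sum_sub_distrib, Finset.sum_div]
    exact Finset.sum_congr rfl fun k _ => by ring
  have hD : weilDistribution L (fun y => (sj y - si y) / c)
      = (weilDistribution L sj - weilDistribution L si) / c := by
    unfold weilDistribution
    rw [hP, hR, hS]
    ring
  have hfun : (fun y => (Real.sin (2 * π * (j : ℤ) * y / L) - Real.sin (2 * π * (i : ℤ) * y / L))
      / (π * ((i : ℤ) - (j : ℤ)))) = fun y => (sj y - si y) / c := by
    funext y; simp only [hsi, hsj, hcdef]
  have hbi : bCoeff L i = -(1 / π) * weilDistribution L si := rfl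
  have hbj : bCoeff L j = -(1 / π) * weilDistribution L sj := rfl
  rw [hfun, hD, hbi, hbj, hcdef]
  field_simp
  ring

/-- **CCM Lemma 5.1 (diagonal entries):** `τ_{i,i} = a_i = 2 ∫₀ᴸ (1 − y/L) cos(2πiy/L) D(y)` (`aCoeff`).
[cite: ConnesConsaniMoscovici2025, Lemma 5.1 eq. (5.2) p. 16] -/
theorem truncatedWeilMatrix_apply_self {L : ℝ} (hL : 0 < L) (N : ℕ) (i : Finset.Icc (-(N : ℤ)) N) :
    truncatedWeilMatrix L N i i = aCoeff L i := by
  rw [truncatedWeilMatrix, Matrix.of_apply, aCoeff]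
  exact weilDistribution_congr hL fun y hy => qKer_self hL i hy

/-- **CCM Lemma 5.1: `τ` is real symmetric** (`(b_i − b_j)/(i − j)` is symmetric in `i, j`).
[cite: ConnesConsaniMoscovici2025, Lemma 5.1 p. 16] -/
theorem truncatedWeilMatrix_symm {L : ℝ} (hL : 0 < L) (N : ℕ) (i j : Finset.Icc (-(N : ℤ)) N) :
    truncatedWeilMatrix L N j i = truncatedWeilMatrix L N i j := by
  by_cases hij : i = j
  · rw [hij]
  · rw [truncatedWeilMatrix_apply_of_ne hL N hij, truncatedWeilMatrix_apply_of_ne hL N (Ne.symm hij)]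
    have h : (((i : ℤ) : ℝ) - ((j : ℤ) : ℝ)) ≠ 0 :=
      sub_ne_zero.mpr (by exact_mod_cast fun h => hij (Subtype.ext h))
    have h' : (((j : ℤ) : ℝ) - ((i : ℤ) : ℝ)) ≠ 0 := fun e => h (by linarith)
    field_simp
    ring

/-- `τ` is Hermitian (real symmetric), in Mathlib's form. [cite: ConnesConsaniMoscovici2025, Lemma 5.1 p. 16] -/
theorem truncatedWeilMatrix_isHermitian {L : ℝ} (hL : 0 < L) (N : ℕ) : (truncatedWeilMatrix L N).IsHermitian := by
  refine Matrix.IsHermitian.ext fun i j => ?_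
  rw [star_trivial]
  exact truncatedWeilMatrix_symm hL N i j

/-- **CCM Lemma 5.2 (ii), eq. (5.3), for the truncated Weil matrix:** `DT − TD = |β⟩⟨η| − |η⟩⟨β|` with
`D V_n = n V_n`, `β = Σ b_j V_j`, `η = Σ V_j`, i.e. `(i − j) τ_{i,j} = b_i − b_j` for all `i, j` — the tree's
`ConnesVanSuijlekom.commutator_of_dividedDifference` applied to Lemma 5.1. [cite: ConnesConsaniMoscovici2025, Lemma 5.2 (ii) eq. (5.3) p. 16] -/
theorem truncatedWeilMatrix_commutator {L : ℝ} (hL : 0 < L) (N : ℕ) (i j : Finset.Icc (-(N : ℤ)) N) :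
    ((((i : ℤ) : ℝ)) - ((j : ℤ) : ℝ)) * truncatedWeilMatrix L N i j = bCoeff L i - bCoeff L j :=
  Literature.LinearAlgebra.Matrix.ConnesVanSuijlekom.commutator_of_dividedDifference
    (lam := fun k : Finset.Icc (-(N : ℤ)) N => ((k : ℤ) : ℝ)) (b := fun k => bCoeff L k)
    (fun k l h => by
      have h' : ((k : ℤ) : ℝ) = ((l : ℤ) : ℝ) := h
      exact Subtype.ext (by exact_mod_cast h'))
    (fun k l hkl => truncatedWeilMatrix_apply_of_ne hL N hkl) i j

/-! ## §5.2: the `ℤ/2`-grading and Definition 5.3 -/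

/-- **CCM Lemma 5.2 (i)** for the kernels: `q(U_{−i}, U_{−j}) = q(U_i, U_j)` ("One has `q_{−i,−j} = q_{i,j}`", proof of
Lemma 5.2 (i)), on `[0, L]`. [cite: ConnesConsaniMoscovici2025, Lemma 5.2 (i) (proof) p. 16] -/
theorem qKer_neg_neg {L : ℝ} (hL : 0 < L) (n m : ℤ) {y : ℝ} (hy : y ∈ Icc 0 L) :
    qKer L (-n) (-m) y = qKer L n m y := by
  by_cases hnm : n = m
  · subst hnm
    rw [qKer_self hL, qKer_self hL, Int.cast_neg,
      show 2 * π * -(n : ℝ) * y / L = -(2 * π * n * y / L) by ring, Real.cos_neg]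
    all_goals exact hy
  · rw [qKer_of_ne hL (fun h => hnm (neg_inj.mp h)) hy, qKer_of_ne hL hnm hy]
    simp only [Int.cast_neg]
    rw [show 2 * π * -(m : ℝ) * y / L = -(2 * π * m * y / L) by ring,
      show 2 * π * -(n : ℝ) * y / L = -(2 * π * n * y / L) by ring, Real.sin_neg, Real.sin_neg]
    rw [show (π * (-(n : ℝ) - -(m : ℝ))) = -(π * (n - m)) by ring, div_neg, ← neg_div]
    congr 1
    ring

/-- **CCM Lemma 5.2 (i)**: the truncated Weil matrix commutes with the grading `γ V_j = V_{−j}`, i.e.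
`τ_{−i,−j} = τ_{i,j}` (and `γ² = id` is `−(−j) = j`). [cite: ConnesConsaniMoscovici2025, Lemma 5.2 (i) p. 16] -/
theorem truncatedWeilMatrix_reflect {L : ℝ} (hL : 0 < L) (N : ℕ) (i j i' j' : Finset.Icc (-(N : ℤ)) N)
    (hi : (i' : ℤ) = -(i : ℤ)) (hj : (j' : ℤ) = -(j : ℤ)) :
    truncatedWeilMatrix L N i' j' = truncatedWeilMatrix L N i j := by
  simp only [truncatedWeilMatrix, Matrix.of_apply, hi, hj]
  exact weilDistribution_congr hL fun y hy => qKer_neg_neg hL i j hy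

/-- **CCM Definition 5.3 (even-simple)**, for a real symmetric matrix `T` on frequencies `S = −S ⊂ ℤ` commuting with `γ`:
"its smallest eigenvalue is simple and the corresponding eigenvector `ξ` satisfies `γξ = ξ`" — in the operator-free form
consumed by the tree's real-zeros theorems (`ConnesVanSuijlekom.fourierIntegral_eq_zero_im_eq_zero_of_length`): there are
`ε` (the smallest eigenvalue) and `ξ ≠ 0` with `T − ε ≥ 0`, `(T − ε)ξ = 0`, `ker(T − ε) = ℝξ`, `ξ_{−k} = ξ_k`.
[cite: ConnesConsaniMoscovici2025, Definition 5.3 p. 16] -/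
def IsEvenSimple (S : Finset ℤ) (T : Matrix S S ℝ) : Prop :=
  ∃ ε : ℝ, ∃ ξ : S → ℝ,
    (T - ε • (1 : Matrix S S ℝ)).PosSemidef ∧ ξ ≠ 0 ∧ (T - ε • (1 : Matrix S S ℝ)) *ᵥ ξ = 0 ∧
      (∀ v : S → ℝ, (T - ε • (1 : Matrix S S ℝ)) *ᵥ v = 0 → ∃ c : ℝ, v = c • ξ) ∧
      ∀ i j : S, (i : ℤ) = -(j : ℤ) → ξ i = ξ j

/-- An even-simple matrix is bounded below by its bottom eigenvalue: `T − ε ≥ 0` for the `ε` of the definition.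
[cite: ConnesConsaniMoscovici2025, Definition 5.3 p. 16] -/
theorem IsEvenSimple.exists_posSemidef {S : Finset ℤ} {T : Matrix S S ℝ} (h : IsEvenSimple S T) :
    ∃ ε : ℝ, (T - ε • (1 : Matrix S S ℝ)).PosSemidef := by
  obtain ⟨ε, ξ, hpsd, -, -, -, -⟩ := h
  exact ⟨ε, hpsd⟩

/-! ## Discharge of Proposition 4.3 (the `W_ℝ` entries) -/

/-- `W♯_ℝ` only sees `φ` on `[0, L]`. [cite: ConnesConsaniMoscovici2026, eq. (4.4) (EMS SLM 37, 2026) = arXiv:2511.22755v1 eq. (4.4) p. 12] -/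
theorem archSharp_congr {L : ℝ} (hL : 0 < L) {φ ψ : ℝ → ℝ} (h : EqOn φ ψ (Icc 0 L)) :
    archSharp L φ = archSharp L ψ := by
  have h0 : φ 0 = ψ 0 := h ⟨le_rfl, hL.le⟩
  have hu : ∀ y ∈ uIcc (0 : ℝ) L, y ∈ Icc (0 : ℝ) L := fun y hy => by rwa [uIcc_of_le hL.le] at hy
  unfold archSharp
  rw [h0]
  congr 1
  exact integral_congr fun y hy => by simp only [h (hu y hy)]

/-- The `ρ`-weighted sine kernel `sin(2πky/L) ρ(y)` is interval-integrable on `[0, L]`. [folklore] -/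
private theorem intervalIntegrable_sin_mul_rho {L : ℝ} (hL : 0 < L) (k : ℤ) :
    IntervalIntegrable (fun y => Real.sin (2 * π * k * y / L) * rho y) volume 0 L := by
  refine (intervalIntegrable_sinKernel hL (2 * π * k / L)).congr fun y _ => ?_
  simp only [rho]
  rw [show 2 * π * (k : ℝ) / L * y = 2 * π * k * y / L by ring]
  ring

/-- The kernel `(cos(ay) − e^{−y/2}) ρ(y)` is bounded on `(0, L]`: `|…| ≤ e^{L/2}(a²L + 1)/4`
(`1 − cos(ay) ≤ a²y²/2`, `0 ≤ 1 − e^{−y/2} ≤ y/2`, `eʸ − e^{−y} ≥ 2y`). [folklore] -/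
private theorem cosKernel_bound {L a y : ℝ} (hy : 0 < y) (hyL : y ≤ L) :
    |(Real.cos (a * y) - Real.exp (-(y / 2))) * rho y| ≤ Real.exp (L / 2) * (a ^ 2 * L + 1) / 4 := by
  have hden : 2 * y ≤ Real.exp y - Real.exp (-y) := two_mul_le_exp_sub_exp_neg hy.le
  have hden0 : 0 < Real.exp y - Real.exp (-y) := by linarith
  have hrho : 0 ≤ rho y := div_nonneg (Real.exp_pos _).le hden0.le
  have hrho' : rho y ≤ Real.exp (L / 2) / (2 * y) := by
    rw [rho, div_le_div_iff₀ hden0 (by positivity)]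
    calc Real.exp (y / 2) * (2 * y) ≤ Real.exp (L / 2) * (2 * y) :=
          mul_le_mul_of_nonneg_right (Real.exp_le_exp.mpr (by linarith)) (by positivity)
      _ ≤ Real.exp (L / 2) * (Real.exp y - Real.exp (-y)) := mul_le_mul_of_nonneg_left hden (Real.exp_pos _).le
  have h1 : |Real.cos (a * y) - Real.exp (-(y / 2))| ≤ a ^ 2 * y ^ 2 / 2 + y / 2 := by
    have hc1 : 1 - (a * y) ^ 2 / 2 ≤ Real.cos (a * y) := Real.one_sub_sq_div_two_le_cos
    have hc2 : Real.cos (a * y) ≤ 1 := Real.cos_le_one _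
    have he1 : 1 - y / 2 ≤ Real.exp (-(y / 2)) := Real.one_sub_le_exp_neg _
    have he2 : Real.exp (-(y / 2)) ≤ 1 := Real.exp_le_one_iff.mpr (by linarith)
    rw [abs_le]
    constructor <;> nlinarith
  rw [abs_mul, abs_of_nonneg hrho]
  calc |Real.cos (a * y) - Real.exp (-(y / 2))| * rho y
      ≤ (a ^ 2 * y ^ 2 / 2 + y / 2) * (Real.exp (L / 2) / (2 * y)) :=
        mul_le_mul h1 hrho' hrho (by positivity)
    _ = Real.exp (L / 2) * (a ^ 2 * y + 1) / 4 := by field_simp; ring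
    _ ≤ Real.exp (L / 2) * (a ^ 2 * L + 1) / 4 := by
        gcongr

/-- The kernel `y cos(ay) ρ(y)` is bounded on `(0, L]`: `|…| ≤ e^{L/2}/2`. [folklore] -/
private theorem mulCosKernel_bound {L a y : ℝ} (hy : 0 < y) (hyL : y ≤ L) :
    |y * Real.cos (a * y) * rho y| ≤ Real.exp (L / 2) / 2 := by
  have hden : 2 * y ≤ Real.exp y - Real.exp (-y) := two_mul_le_exp_sub_exp_neg hy.le
  have hden0 : 0 < Real.exp y - Real.exp (-y) := by linarith
  have hrho : 0 ≤ rho y := div_nonneg (Real.exp_pos _).le hden0.le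
  rw [abs_mul, abs_mul, abs_of_pos hy, abs_of_nonneg hrho, rho]
  calc y * |Real.cos (a * y)| * (Real.exp (y / 2) / (Real.exp y - Real.exp (-y)))
      ≤ y * 1 * (Real.exp (L / 2) / (2 * y)) := by
        refine mul_le_mul (mul_le_mul_of_nonneg_left (Real.abs_cos_le_one _) hy.le) ?_ (by positivity)
          (by positivity)
        rw [div_le_div_iff₀ hden0 (by positivity)]
        calc Real.exp (y / 2) * (2 * y) ≤ Real.exp (L / 2) * (2 * y) :=
              mul_le_mul_of_nonneg_right (Real.exp_le_exp.mpr (by linarith)) (by positivity)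
          _ ≤ Real.exp (L / 2) * (Real.exp y - Real.exp (-y)) :=
              mul_le_mul_of_nonneg_left hden (Real.exp_pos _).le
    _ = Real.exp (L / 2) / 2 := by field_simp

/-- Interval-integrability on `[0, L]` of a measurable function bounded on `(0, L]`. [folklore] -/
private theorem intervalIntegrable_of_bound {L : ℝ} (hL : 0 < L) {f : ℝ → ℝ} (hf : Measurable f) (C : ℝ)
    (hb : ∀ y, 0 < y → y ≤ L → |f y| ≤ C) : IntervalIntegrable f volume 0 L := by
  rw [intervalIntegrable_iff_integrableOn_Ioc_of_le hL.le]
  refine Measure.integrableOn_of_bounded (M := C) measure_Ioc_lt_top.ne hf.aestronglyMeasurable ?_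
  rw [ae_restrict_iff' measurableSet_Ioc]
  exact Filter.Eventually.of_forall fun y hy => by
    rw [Real.norm_eq_abs]
    exact hb y hy.1 hy.2

/-- `log(4π (eᴸ − 1)/(eᴸ + 1)) = log 4π − log((eᴸ + 1)/(eᴸ − 1))` (`L > 0`), i.e. the `φ(0)`-coefficient of (4.4) is `2w(L)`.
[folklore] -/
private theorem log_coeff_eq_two_wL {L : ℝ} (hL : 0 < L) :
    Real.eulerMascheroniConstant + Real.log (4 * π * (Real.exp L - 1) / (Real.exp L + 1)) = 2 * wL L := by
  have h1 : 0 < Real.exp L - 1 := by linarith [Real.add_one_le_exp L]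
  have h2 : 0 < Real.exp L + 1 := by positivity
  rw [wL, mul_div_assoc, Real.log_mul (by positivity) (div_pos h1 h2).ne', Real.log_div h1.ne' h2.ne',
    Real.log_div h2.ne' h1.ne']
  ring

/-- **CCM Proposition 4.3 — DISCHARGED** (with `γ_L` as corrected, see the module docstring): the `W_ℝ` entries are
`(α_L(m) − α_L(n))/(n − m)` off the diagonal and `2γ_L(n) − 2β_L(n)` on it. Proof as printed ("Follows from Lemma 2.3" and
(4.4)): insert the closed forms of `q(U_n, U_m)` on `[0, L]` and split the integral (the `ρ`-weighted kernels are bounded on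
`(0, L]`, hence integrable). [cite: ConnesConsaniMoscovici2026, Proposition 4.3 (EMS SLM 37, 2026) = arXiv:2511.22755v1 Proposition 4.3 p. 15] -/
theorem CCM2025_prop_4_3_holds : CCM2025_prop_4_3 := by
  intro L hL n m
  by_cases hnm : n = m
  · -- diagonal
    subst hnm
    rw [if_pos rfl, archSharp_congr hL (fun y hy => qKer_self hL n hy)]
    set a : ℝ := 2 * π * n / L with ha
    have hcos : ∀ y : ℝ, Real.cos (2 * π * n * y / L) = Real.cos (a * y) := fun y => by
      rw [ha]; ring_nf
    simp only [archSharp, gammaL, betaL, hcos, mul_zero, zero_div, sub_zero, Real.cos_zero, mul_one]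
    -- the integrand, pointwise (valid also at `y = 0`, where both sides are `0/0 = 0`)
    have hpt : ∀ y : ℝ, (Real.exp (y / 2) * (2 * (1 - y / L) * Real.cos (a * y)) - 2)
          / (Real.exp y - Real.exp (-y))
        = 2 * ((Real.cos (a * y) - Real.exp (-(y / 2))) * rho y) - 2 / L * (y * Real.cos (a * y) * rho y) := by
      intro y
      have h1 : Real.exp (-(y / 2)) * Real.exp (y / 2) = 1 := by rw [← Real.exp_add]; simp
      rw [rho, mul_div_assoc', mul_div_assoc', mul_div_assoc', mul_div_assoc', div_sub_div_same]
      congr 1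
      linear_combination (2 : ℝ) * h1
    have hI1 : IntervalIntegrable (fun y => (Real.cos (a * y) - Real.exp (-(y / 2))) * rho y) volume 0 L :=
      intervalIntegrable_of_bound hL (by unfold rho; fun_prop) _ fun y hy hyL => cosKernel_bound hy hyL
    have hI2 : IntervalIntegrable (fun y => y * Real.cos (a * y) * rho y) volume 0 L :=
      intervalIntegrable_of_bound hL (by unfold rho; fun_prop) _ fun y hy hyL => mulCosKernel_bound hy hyL
    rw [intervalIntegral.integral_congr (fun y _ => hpt y), intervalIntegral.integral_sub (hI1.const_mul 2)
      (hI2.const_mul (2 / L)), intervalIntegral.integral_const_mul, intervalIntegral.integral_const_mul]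
    have hw := log_coeff_eq_two_wL hL
    have hL0 : L ≠ 0 := hL.ne'
    field_simp
    linear_combination L * hw
  · -- off-diagonal
    rw [if_neg hnm, archSharp_congr hL (fun y hy => qKer_of_ne hL hnm hy)]
    have hc : (π * ((n : ℝ) - (m : ℝ))) ≠ 0 :=
      mul_ne_zero Real.pi_ne_zero (sub_ne_zero.mpr (by exact_mod_cast hnm))
    simp only [archSharp, alphaL, mul_zero, zero_div, sub_zero, Real.sin_zero, zero_mul, zero_add, sub_self]
    have hpt : ∀ y : ℝ, Real.exp (y / 2) * ((Real.sin (2 * π * m * y / L) - Real.sin (2 * π * n * y / L))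
          / (π * (n - m))) / (Real.exp y - Real.exp (-y))
        = (1 / (π * (n - m))) * (Real.sin (2 * π * m * y / L) * rho y - Real.sin (2 * π * n * y / L) * rho y) := by
      intro y
      rw [rho]
      field_simp
    rw [intervalIntegral.integral_congr (fun y _ => hpt y), intervalIntegral.integral_const_mul,
      intervalIntegral.integral_sub (intervalIntegrable_sin_mul_rho hL m) (intervalIntegrable_sin_mul_rho hL n)]
    field_simp

end Literature.NumberTheory.ConnesConsani2025
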